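import Literature.Probability.Process.BrownianMotion
import Literature.Probability.Distributions.GaussianQuadraticExp
import HarnessLib

/-!
# Gaussian functionals of a pair of Brownian increments (topic `Probability/Process`)

For a real pre-Brownian motion `B` (Mathlib's `ProbabilityTheory.IsPreBrownianReal`) and times
`s, t, u, v`, the pair of increments `(B_t - B_s, B_v - B_u)` is a centred Gaussian vector with
`Var(B_t - B_s) = |t - s|`, `Var(B_v - B_u) = |v - u|` and
`Cov(B_t - B_s, B_v - B_u) = t ∧ v - t ∧ u - s ∧ v + s ∧ u` (the signed length of the overlap of
the two time intervals); hence, by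
`Literature.Probability.Distributions.integral_exp_neg_quadratic_of_hasGaussianLaw`, for
`k, l ≥ 0`,

`E exp(-(k (B_t - B_s)² + l (B_v - B_u)²)/2) = ((1 + k|t-s|)(1 + l|v-u|) - k l c²)^{-1/2}`

(`integral_exp_neg_quadratic_increments`). For a planar Brownian motion `Z`
(`Literature.Probability.Process.IsBrownianComplex`: independent real and imaginary parts) the
two coordinates contribute independent identical factors, so

`E exp(-(k |Z_t - Z_s|² + l |Z_v - Z_u|²)/2) = ((1 + k|t-s|)(1 + l|v-u|) - k l c²)^{-1}`

(`IsBrownianComplex.integral_exp_neg_normSq_increments`), in particular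
`E exp(-k |Z_t - Z_s|²/2) = (1 + k|t - s|)^{-1}` — i.e. `E p_ε(Z_t - Z_s) = p_{ε + |t-s|}(0)` for
the planar heat kernel. These are the inputs of Varadhan's second-moment computation for the
mollified self-intersection local time
(`Literature.Barriers.CriticalPhenomena.Edwards2D.mollifiedSILT`).

The five statements about a real pre-Brownian motion are dot-notation extensions of Mathlib's
`ProbabilityTheory.IsPreBrownianReal`, deliberately declared in that Mathlib namespace (as in
`BrownianPair.lean`); everything else lives in `Literature.Probability.Process`.

## References

* J.-F. Le Gall, *Sur le temps local d'intersection du mouvement brownien plan et la méthode de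
  renormalisation de Varadhan*, Sém. Prob. XIX, LNM 1123 (1985), §2, (2-a) (the first-moment
  formula `E[α(y,B)] = ∫∫_B (2π(t-s))⁻¹ exp(-|y|²/2(t-s)) ds dt`).
* D. Revuz, M. Yor, *Continuous Martingales and Brownian Motion* (1999), Ch. I §1 (Gaussian
  finite-dimensional laws of Brownian motion). [folklore]
-/

noncomputable section

namespace Literature.Probability.Process

open MeasureTheory ProbabilityTheory Real
open scoped NNReal ENNReal

variable {Ω : Type*} {mΩ : MeasurableSpace Ω} {P : Measure Ω}

/-- The signed overlap `t ∧ v - t ∧ u - s ∧ v + s ∧ u` of the time intervals from `s` to `t` and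
from `u` to `v`: the covariance of the Brownian increments `B_t - B_s` and `B_v - B_u`
(`IsPreBrownianReal.covariance_increments`). [folklore] -/
def incrCov (s t u v : ℝ) : ℝ := min t v - min t u - min s v + min s u

/-- `incrCov` is continuous in its four arguments (compositional form, for `fun_prop`).
[folklore] -/
@[fun_prop]
theorem continuous_incrCov_comp {α : Type*} [TopologicalSpace α] {f g h i : α → ℝ}
    (hf : Continuous f) (hg : Continuous g) (hh : Continuous h) (hi : Continuous i) :
    Continuous fun x => incrCov (f x) (g x) (h x) (i x) := by
  unfold incrCov
  fun_prop

/-- `incrCov` is measurable in its four arguments (compositional form, for `fun_prop`).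
[folklore] -/
@[fun_prop]
theorem measurable_incrCov_comp {α : Type*} [MeasurableSpace α] {f g h i : α → ℝ}
    (hf : Measurable f) (hg : Measurable g) (hh : Measurable h) (hi : Measurable i) :
    Measurable fun x => incrCov (f x) (g x) (h x) (i x) := by
  unfold incrCov
  fun_prop

/-- `incrCov` changes sign when the first interval is reversed. [folklore] -/
theorem incrCov_swap_left (s t u v : ℝ) : incrCov t s u v = -incrCov s t u v := by
  unfold incrCov
  ring

/-- `incrCov` changes sign when the second interval is reversed. [folklore] -/
theorem incrCov_swap_right (s t u v : ℝ) : incrCov s t v u = -incrCov s t u v := by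
  unfold incrCov
  ring

/-- `incrCov` is symmetric under exchanging the two intervals. [folklore] -/
theorem incrCov_comm (s t u v : ℝ) : incrCov u v s t = incrCov s t u v := by
  unfold incrCov
  rw [min_comm v t, min_comm v s, min_comm u t, min_comm u s]
  ring

section Real

variable {B : ℝ≥0 → Ω → ℝ}

/-- The pair of increments `(B_t - B_s, B_v - B_u)` of a pre-Brownian motion is a Gaussian
vector (a linear image of the finite-dimensional marginal on `{s, t, u, v}`). Dot-notation extension
of Mathlib's `ProbabilityTheory.IsPreBrownianReal`, deliberately declared in Mathlib's namespace
`ProbabilityTheory.IsPreBrownianReal`. [folklore] -/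
theorem _root_.ProbabilityTheory.IsPreBrownianReal.hasGaussianLaw_increments_pair
    (hB : IsPreBrownianReal B P) (s t u v : ℝ≥0) :
    HasGaussianLaw (fun ω ↦ (B t ω - B s ω, B v ω - B u ω)) P := by
  classical
  let I : Finset ℝ≥0 := {s, t, u, v}
  let e : I → ((I → ℝ) →L[ℝ] ℝ) := fun i => ContinuousLinearMap.proj (R := ℝ) (φ := fun _ : I => ℝ) i
  let L : (I → ℝ) →L[ℝ] ℝ × ℝ :=
    ContinuousLinearMap.prod (e ⟨t, by simp [I]⟩ - e ⟨s, by simp [I]⟩)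
      (e ⟨v, by simp [I]⟩ - e ⟨u, by simp [I]⟩)
  have h := (hB.isGaussianProcess.hasGaussianLaw I).map L
  have hfun : (⇑L ∘ fun ω ↦ I.restrict (B · ω)) = fun ω ↦ (B t ω - B s ω, B v ω - B u ω) := by
    funext ω
    simp [L, e]
  rw [hfun] at h
  exact h

/-- `incrCov s t s t = |t - s|` (the variance of one increment). [folklore] -/
theorem incrCov_self (s t : ℝ) : incrCov s t s t = |t - s| := by
  simp only [incrCov, min_self]
  rcases le_total t s with h | h
  · rw [min_eq_left h, min_eq_right h, abs_of_nonpos (by linarith)]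
    ring
  · rw [min_eq_right h, min_eq_left h, abs_of_nonneg (by linarith)]
    ring

/-- `E(B_t - B_s) = 0`. Dot-notation extension of Mathlib's `ProbabilityTheory.IsPreBrownianReal`,
deliberately declared in Mathlib's namespace `ProbabilityTheory.IsPreBrownianReal`. [folklore] -/
theorem _root_.ProbabilityTheory.IsPreBrownianReal.integral_increment
    (hB : IsPreBrownianReal B P) (s t : ℝ≥0) :
    P[fun ω ↦ B t ω - B s ω] = 0 := by
  rw [integral_sub (hB.integrable_eval t) (hB.integrable_eval s), hB.integral_eval,
    hB.integral_eval, sub_zero]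

/-- **Covariance of two Brownian increments**:
`Cov(B_t - B_s, B_v - B_u) = t ∧ v - t ∧ u - s ∧ v + s ∧ u` (bilinearity and
`Cov(B_s, B_t) = s ∧ t`, Mathlib's `IsPreBrownianReal.covariance_fun_eval`). Dot-notation extension
of Mathlib's `ProbabilityTheory.IsPreBrownianReal`, deliberately declared in Mathlib's namespace
`ProbabilityTheory.IsPreBrownianReal`. [folklore] -/
theorem _root_.ProbabilityTheory.IsPreBrownianReal.covariance_increments
    (hB : IsPreBrownianReal B P) (s t u v : ℝ≥0) :
    cov[fun ω ↦ B t ω - B s ω, fun ω ↦ B v ω - B u ω; P] = incrCov s t u v := by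
  have : IsProbabilityMeasure P := hB.isGaussianProcess.isProbabilityMeasure
  have hm : ∀ r : ℝ≥0, MemLp (fun ω ↦ B r ω) 2 P :=
    fun r => (hB.isGaussianProcess.hasGaussianLaw_eval r).memLp_two
  rw [covariance_fun_sub_fun_sub (hm t) (hm s) (hm v) (hm u), hB.covariance_fun_eval,
    hB.covariance_fun_eval, hB.covariance_fun_eval, hB.covariance_fun_eval, incrCov]
  push_cast
  ring

/-- `Var(B_t - B_s) = |t - s|`. Dot-notation extension of Mathlib's
`ProbabilityTheory.IsPreBrownianReal`, deliberately declared in Mathlib's namespace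
`ProbabilityTheory.IsPreBrownianReal`. [folklore] -/
theorem _root_.ProbabilityTheory.IsPreBrownianReal.variance_increment
    (hB : IsPreBrownianReal B P) (s t : ℝ≥0) :
    Var[fun ω ↦ B t ω - B s ω; P] = |(t : ℝ) - s| := by
  have hae : AEMeasurable (fun ω ↦ B t ω - B s ω) P := (hB.aemeasurable t).sub (hB.aemeasurable s)
  rw [← covariance_self hae, hB.covariance_increments, incrCov_self]

/-- **Gaussian functional of a pair of Brownian increments**: for `k, l ≥ 0`,
`E exp(-(k (B_t - B_s)² + l (B_v - B_u)²)/2) = 1/√((1 + k|t-s|)(1 + l|v-u|) - k l c²)` with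
`c = Cov(B_t - B_s, B_v - B_u) = incrCov s t u v`. Dot-notation extension of Mathlib's
`ProbabilityTheory.IsPreBrownianReal`, deliberately declared in Mathlib's namespace
`ProbabilityTheory.IsPreBrownianReal`. [folklore] -/
theorem _root_.ProbabilityTheory.IsPreBrownianReal.integral_exp_neg_quadratic_increments
    (hB : IsPreBrownianReal B P) (s t u v : ℝ≥0) {k l : ℝ} (hk : 0 ≤ k) (hl : 0 ≤ l) :
    ∫ ω, rexp (-(k * (B t ω - B s ω) ^ 2 + l * (B v ω - B u ω) ^ 2) / 2) ∂P =
      1 / √((1 + k * |(t : ℝ) - s|) * (1 + l * |(v : ℝ) - u|) - k * l * incrCov s t u v ^ 2) := by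
  have : IsProbabilityMeasure P := hB.isGaussianProcess.isProbabilityMeasure
  exact Literature.Probability.Distributions.integral_exp_neg_quadratic_of_hasGaussianLaw
    (hB.hasGaussianLaw_increments_pair s t u v) (hB.integral_increment s t)
    (hB.integral_increment u v) (hB.variance_increment s t) (hB.variance_increment u v)
    (hB.covariance_increments s t u v) hk hl

end Real

section Complex

variable {Z : ℝ≥0 → Ω → ℂ}

/-- The functional `p ↦ exp(-(k (p t - p s)² + l (p v - p u)²)/2)` on real paths is measurable
for the product σ-algebra. [folklore] -/
theorem measurable_exp_neg_quadratic_path (s t u v : ℝ≥0) (k l : ℝ) :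
    Measurable fun p : ℝ≥0 → ℝ => rexp (-(k * (p t - p s) ^ 2 + l * (p v - p u) ^ 2) / 2) := by
  have h1 : Measurable fun p : ℝ≥0 → ℝ => p t := measurable_pi_apply t
  have h2 : Measurable fun p : ℝ≥0 → ℝ => p s := measurable_pi_apply s
  have h3 : Measurable fun p : ℝ≥0 → ℝ => p v := measurable_pi_apply v
  have h4 : Measurable fun p : ℝ≥0 → ℝ => p u := measurable_pi_apply u
  fun_prop

/-- `|z|² = (re z)² + (im z)²` in the form used below. [folklore] -/
theorem norm_sq_eq_re_sq_add_im_sq (z : ℂ) : ‖z‖ ^ 2 = z.re ^ 2 + z.im ^ 2 := by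
  rw [Complex.sq_norm, Complex.normSq_apply]
  ring

/-- **Gaussian functional of a pair of planar Brownian increments**: for a planar Brownian
motion `Z` with measurable marginals and `k, l ≥ 0`,
`E exp(-(k |Z_t - Z_s|² + l |Z_v - Z_u|²)/2) = 1/((1 + k|t-s|)(1 + l|v-u|) - k l c²)`,
`c = incrCov s t u v`: the real and imaginary parts are independent Brownian motions and each
contributes the factor `IsPreBrownianReal.integral_exp_neg_quadratic_increments`; the
discriminant is positive. [folklore] -/
theorem IsBrownianComplex.integral_exp_neg_normSq_increments [IsProbabilityMeasure P]
    (hZ : IsBrownianComplex Z P) (hmeas : ∀ t, Measurable (Z t)) (s t u v : ℝ≥0) {k l : ℝ}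
    (hk : 0 ≤ k) (hl : 0 ≤ l) :
    0 < (1 + k * |(t : ℝ) - s|) * (1 + l * |(v : ℝ) - u|) - k * l * incrCov s t u v ^ 2 ∧
    ∫ ω, rexp (-(k * ‖Z t ω - Z s ω‖ ^ 2 + l * ‖Z v ω - Z u ω‖ ^ 2) / 2) ∂P =
      1 / ((1 + k * |(t : ℝ) - s|) * (1 + l * |(v : ℝ) - u|) - k * l * incrCov s t u v ^ 2) := by
  set D : ℝ := (1 + k * |(t : ℝ) - s|) * (1 + l * |(v : ℝ) - u|) - k * l * incrCov s t u v ^ 2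
    with hD
  set φ : (ℝ≥0 → ℝ) → ℝ := fun p => rexp (-(k * (p t - p s) ^ 2 + l * (p v - p u) ^ 2) / 2)
    with hφ
  have hφm : Measurable φ := measurable_exp_neg_quadratic_path s t u v k l
  -- the real and imaginary path maps
  set Xr : Ω → (ℝ≥0 → ℝ) := fun ω r => (Z r ω).re with hXr
  set Xi : Ω → (ℝ≥0 → ℝ) := fun ω r => (Z r ω).im with hXi
  have hXrm : Measurable Xr := measurable_pi_lambda _ fun r => Complex.measurable_re.comp (hmeas r)
  have hXim : Measurable Xi := measurable_pi_lambda _ fun r => Complex.measurable_im.comp (hmeas r)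
  have hind : IndepFun (φ ∘ Xr) (φ ∘ Xi) P := hZ.indepFun.comp hφm hφm
  -- split the integrand
  have hsplit : ∀ ω, rexp (-(k * ‖Z t ω - Z s ω‖ ^ 2 + l * ‖Z v ω - Z u ω‖ ^ 2) / 2) =
      (φ ∘ Xr) ω * (φ ∘ Xi) ω := by
    intro ω
    simp only [Function.comp_apply, hφ, hXr, hXi]
    rw [← Real.exp_add, norm_sq_eq_re_sq_add_im_sq, norm_sq_eq_re_sq_add_im_sq,
      Complex.sub_re, Complex.sub_re, Complex.sub_im, Complex.sub_im]
    congr 1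
    ring
  have hre : ∫ ω, (φ ∘ Xr) ω ∂P = 1 / √D := by
    simp only [Function.comp_apply, hφ, hXr]
    exact hZ.re.toIsPreBrownianReal.integral_exp_neg_quadratic_increments s t u v hk hl
  have him : ∫ ω, (φ ∘ Xi) ω ∂P = 1 / √D := by
    simp only [Function.comp_apply, hφ, hXi]
    exact hZ.im.toIsPreBrownianReal.integral_exp_neg_quadratic_increments s t u v hk hl
  have hprod : ∫ ω, rexp (-(k * ‖Z t ω - Z s ω‖ ^ 2 + l * ‖Z v ω - Z u ω‖ ^ 2) / 2) ∂P =
      1 / √D * (1 / √D) := by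
    simp_rw [hsplit]
    rw [hind.integral_fun_mul_eq_mul_integral (hφm.comp hXrm).aestronglyMeasurable
      (hφm.comp hXim).aestronglyMeasurable, hre, him]
  -- positivity of the discriminant from positivity of the expectation
  have hpos : 0 < ∫ ω, rexp (-(k * ‖Z t ω - Z s ω‖ ^ 2 + l * ‖Z v ω - Z u ω‖ ^ 2) / 2) ∂P := by
    refine integral_exp_pos (Integrable.of_bound ?_ 1 (ae_of_all _ fun ω => ?_))
    · have h1 : Measurable fun ω => rexp (-(k * ‖Z t ω - Z s ω‖ ^ 2 + l * ‖Z v ω - Z u ω‖ ^ 2) / 2) := by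
        have := hmeas t; have := hmeas s; have := hmeas u; have := hmeas v
        fun_prop
      exact h1.aestronglyMeasurable
    · rw [Real.norm_eq_abs, abs_of_nonneg (Real.exp_pos _).le, Real.exp_le_one_iff]
      have : 0 ≤ k * ‖Z t ω - Z s ω‖ ^ 2 + l * ‖Z v ω - Z u ω‖ ^ 2 := by positivity
      linarith
  have hDpos : 0 < D := by
    rw [hprod] at hpos
    have h1 : 0 < 1 / √D := by
      rcases (mul_pos_iff.1 hpos) with h | h
      · exact h.1
      · exact absurd h.1 (not_lt.2 (by positivity))
    have h2 : 0 < √D := by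
      by_contra h
      have : √D = 0 := le_antisymm (not_lt.1 h) (Real.sqrt_nonneg D)
      rw [this, div_zero] at h1
      exact lt_irrefl 0 h1
    exact Real.sqrt_pos.1 h2
  refine ⟨hDpos, ?_⟩
  rw [hprod, div_mul_div_comm, one_mul, Real.mul_self_sqrt hDpos.le]

/-- In particular `E exp(-k|Z_t - Z_s|²/2) = 1/(1 + k|t - s|)` for `k ≥ 0`
(`E p_ε(Z_t - Z_s) = p_{ε+|t-s|}(0)` for the planar heat kernel, `ε = 1/k`). [folklore] -/
theorem IsBrownianComplex.integral_exp_neg_normSq_increment [IsProbabilityMeasure P]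
    (hZ : IsBrownianComplex Z P) (hmeas : ∀ t, Measurable (Z t)) (s t : ℝ≥0) {k : ℝ}
    (hk : 0 ≤ k) :
    ∫ ω, rexp (-(k * ‖Z t ω - Z s ω‖ ^ 2) / 2) ∂P = 1 / (1 + k * |(t : ℝ) - s|) := by
  have h := (hZ.integral_exp_neg_normSq_increments hmeas s t s t hk le_rfl).2
  simpa using h

end Complex

end Literature.Probability.Process
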